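/-
Copyright: the b2b-balaban T⁴-continuum CRUX team, row NE7b leaf lineage `t4-ne7b-formalise-leaf-03` (gen 150). Project licence.
-/
import Mathlib.Analysis.InnerProductSpace.Basic
import Mathlib.Analysis.Calculus.FDeriv.Comp

/-!
# TWO HARD STEPS ARE ONE — IN THE TWO OTHER CURRENCIES OF THE CELL: on the KKT road (nonlinear constraints `G₁`, `G₂`) the KKT
# points compose and the composite's multiplier is the LAST one, `DV(x⋆) = λ₂(g) ∘ D(G₂ ∘ G₁)(x⋆)`; in the quadratic model the
# constrained minimiser ∕ multiplier PAIRS of `…ConstrainedSchurForm` compose, `(M₁ ∘ M₂, Λ₂)` serving `(H, D₂ ∘ D₁)` — the constrained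
# Schur complement under `D₂ ∘ D₁` IS the complement under `D₂` of the complement under `D₁`, inverse-free (row NE7b, node U5c; the
# companion of this lineage's `…HardStepSemigroup` (HSSG: linear sections ∕ transported forms ∕ constrained criticality compose);
# Mathlib only; [folklore] — the chain rule, two rewrites)

Cell `pub-balaban`, sub-cell `t4`, spine estimate NE7b (`T4WeightBudget.RelWeightBound`; the cell's OWN estimate — NOT PRINTED in
[Bałaban 1983–89], NOT PROVED).  Crux-route work under `Spine/NE7b/` by leaf-03 (CRUX team (2), FREEZE (0) crux-prover clause) in the
hard-step cell.  NOTHING of Bałaban's is named, asserted, valued or discharged; no `T4Continuum/Support` leaf typed; no `def`; zero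
`sorry`.  Imports: Mathlib ONLY — independent of the `Spine/NE7b` olean frontier.  Met BY SHAPE (not imported, nothing restated): this
lineage's `…HardStepSemigroup` (HSSG §4 `critical_comp`: the linear-constraint case), `…HardStepKKTBranch` ∕ `…HardStepKKTInductiveStep`
(HKB ∕ HKIS: the KKT letter `DV(δ w) = λ(w) ∘ DG(δ w)` of conclusion (a) and «the next gradient IS the multiplier» `D(V ∘ δ)(w) = λ(w)` of
conclusion (b)), `…ConstrainedSchurForm` §3 (CSF: the pair letters `D (M w) = w`, `⟪H (M w), δ⟫ = ⟪Λ w, D δ⟫` — «`H M = D† Λ`», `Λ` the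
constrained Schur complement «`(D H⁻¹ D†)⁻¹`» read without inverses — and `min_eq_multiplierForm`).

WHY.  HSSG types the semigroup law of the hard step for LINEAR blockings (critical sections and transported Hessians compose; constrained
criticality of `V` composes), answering the pricing desk's F689 (5) «print carries the Gaussian part in closed form, uniformly in `k`» at
the level of shape.  The cell runs the same step in two further currencies, and the law is one line in each: (§1) on the KKT road
(Bałaban's averaging constraint is nonlinear, [B8] (134)–(135); this lineage's HKB → KCDM → HKIS chain) a KKT point of `V ∘ δ₁` for `G₂`
above a KKT branch `δ₁` of `V` for `G₁` is a KKT point of `V` for `G₂ ∘ G₁`, with the SECOND multiplier — because by HKIS (b) the first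
multiplier IS the next gradient, so step 2's KKT letter rewrites it, and the chain rule assembles `D(G₂ ∘ G₁)`; (§2) in the quadratic
model (CSF's pair letters, the Gaussian skeleton's `Δ_k`) the pairs compose by two rewrites, so the recursion `Δ_{k+1} = S_{D}(Δ_k)` and
the closed form `Δ_k = S_{D^{(k)}}(Δ_0)` are the same object with no inverse taken (Dimock, Rev. Math. Phys. 25 (2013) (54), Lemmas 3–5,
by value for print's operators — not used here).

WHAT IS PROVED ([folklore]; §1: `E`, `F`, `G` real normed spaces, `V : E → ℝ`, constraints `G₁ : E → F`, `G₂ : F → G`, branches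
`δ₁ : F → E`, `δ₂ : G → F`, multipliers `λ₁ : F → (F →L ℝ)`, `λ₂ : G → (G →L ℝ)`, everything AT ONE POINT `g`; §2: `E`, `F`, `G` real
inner-product spaces, `H : E →ₗ E`, `D₁ : E →ₗ F`, `D₂ : F →ₗ G`, pairs `(M₁, Λ₁)`, `(M₂, Λ₂)` as plain maps with CSF's two letters each):
* §1 **`kkt_comp`** — fibre letter `G₁ (δ₁ (δ₂ g)) = δ₂ g`, `G₁` differentiable at `x⋆ := δ₁ (δ₂ g)`, `G₂` at `δ₂ g`, step 1's KKT letter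
  `DV(x⋆) = λ₁(δ₂ g) ∘ DG₁(x⋆)`, HKIS (b) `D(V ∘ δ₁)(δ₂ g) = λ₁(δ₂ g)`, step 2's KKT letter `D(V ∘ δ₁)(δ₂ g) = λ₂(g) ∘ DG₂(δ₂ g)` ⟹
  `DV(x⋆) = λ₂(g) ∘ D(G₂ ∘ G₁)(x⋆)`; `multiplier_comp` (`λ₁(δ₂ g) = λ₂(g) ∘ DG₂(δ₂ g)` — the multiplier bookkeeping on its own).
* §2 **`schur_pair_comp`** — `D₁ (M₁ w) = w`, `⟪H (M₁ w), δ⟫ = ⟪Λ₁ w, D₁ δ⟫`, `D₂ (M₂ g) = g`, `⟪Λ₁ (M₂ g), v⟫ = ⟪Λ₂ g, D₂ v⟫` ⟹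
  `(D₂ ∘ D₁)(M₁ M₂ g) = g` and `⟪H (M₁ M₂ g), δ⟫ = ⟪Λ₂ g, D₂ (D₁ δ)⟫` (the pair `(M₁ ∘ M₂, Λ₂)` serves `(H, D₂ ∘ D₁)`, so every CSF §3 ∕ §7
  theorem applies to the composite AT ONCE: `constrInf_quadForm_eq_multiplierForm`, `multiplier_symm ∕ _nonneg ∕ _pos`, `floor_multiplierForm`);
  `schur_pair_comp_form` (`⟪M₁ M₂ g, H (M₁ M₂ g)⟫ = ⟪g, Λ₂ g⟫`).
* §3 toys on `ℝ`.

NOT HERE (honest): existence of the pairs (CSF §4 in finite dimension; HKB on the KKT road); which constraints ∕ forms are Bałaban's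
((A3) ∕ (A1c), NC-NE7b-α UNRULED); anything by value.  BY-NAME EFFECT ON THE WALL: NONE.  NE7b NOT PRINTED ∕ NOT PROVED; spine PROVED
0∕9; rung (B)+1 on a FINITE torus — NOT infinite volume, NOT the mass gap, NOT Clay.  HONEST DEPENDENCY: continuum YM on T⁴ ⇐ BetaPertH ∧
nine spine estimates (0∕9 proved); BetaPertH ⇐ (D1) ∧ (D4) ∧ CAP+tail; G-an2-4 gates asym, D1 and NE2∕3∕4.
-/

set_option autoImplicit false

namespace Summit.QuantumFields.BalabanUV.T4Continuum.NE7b.HardStepSemigroupPairs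

/-! ## §1. The KKT road: KKT points compose, with the LAST multiplier -/

section KKT

variable {E F G : Type*} [NormedAddCommGroup E] [NormedSpace ℝ E] [NormedAddCommGroup F] [NormedSpace ℝ F]
  [NormedAddCommGroup G] [NormedSpace ℝ G]

/-- **KKT POINTS COMPOSE (nonlinear constraints; the KKT road's twin of `…HardStepSemigroup.critical_comp`).**  Step 1: at `x⋆ = δ₁ (δ₂ g)` the KKT
letter of `V` for the constraint `G₁` with multiplier `λ₁ (δ₂ g)` (HKB ∕ HKIS (a): `DV(δ₁ w) = λ₁(w) ∘ DG₁(δ₁ w)`) and the next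
gradient IS the multiplier (HKIS (b): `D(V ∘ δ₁)(w) = λ₁(w)`); step 2: the KKT letter of `V ∘ δ₁` for `G₂` at `δ₂ g` with multiplier
`λ₂ g`; the fibre letter `G₁ x⋆ = δ₂ g` and differentiability of `G₁` at `x⋆`, of `G₂` at `δ₂ g` ⟹ `x⋆` is a KKT point of `V` for the
COMPOSITE constraint `G₂ ∘ G₁` with multiplier `λ₂ g`: `DV(x⋆) = λ₂(g) ∘ D(G₂ ∘ G₁)(x⋆)` (chain rule). [folklore] -/
theorem kkt_comp {V : E → ℝ} {G₁ : E → F} {G₂ : F → G} {δ₁ : F → E} {δ₂ : G → F} {lam₁ : F → (F →L[ℝ] ℝ)}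
    {lam₂ : G → (G →L[ℝ] ℝ)} {g : G} (hfib₁ : G₁ (δ₁ (δ₂ g)) = δ₂ g)
    (hG₁d : DifferentiableAt ℝ G₁ (δ₁ (δ₂ g))) (hG₂d : DifferentiableAt ℝ G₂ (δ₂ g))
    (hkkt₁ : fderiv ℝ V (δ₁ (δ₂ g)) = (lam₁ (δ₂ g)).comp (fderiv ℝ G₁ (δ₁ (δ₂ g))))
    (hgrad₁ : fderiv ℝ (V ∘ δ₁) (δ₂ g) = lam₁ (δ₂ g))
    (hkkt₂ : fderiv ℝ (V ∘ δ₁) (δ₂ g) = (lam₂ g).comp (fderiv ℝ G₂ (δ₂ g))) :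
    fderiv ℝ V (δ₁ (δ₂ g)) = (lam₂ g).comp (fderiv ℝ (G₂ ∘ G₁) (δ₁ (δ₂ g))) := by
  have hchain : fderiv ℝ (G₂ ∘ G₁) (δ₁ (δ₂ g)) = (fderiv ℝ G₂ (G₁ (δ₁ (δ₂ g)))).comp (fderiv ℝ G₁ (δ₁ (δ₂ g))) :=
    fderiv_comp (δ₁ (δ₂ g)) (by rw [hfib₁]; exact hG₂d) hG₁d
  rw [hchain, hfib₁, ← ContinuousLinearMap.comp_assoc, ← hkkt₂, hgrad₁, hkkt₁]

omit [NormedAddCommGroup E] [NormedSpace ℝ E] in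
/-- The multiplier bookkeeping read on its own: the first step's multiplier at the second branch point is the second multiplier
pulled back along `DG₂` — `λ₁(δ₂ g) = λ₂(g) ∘ DG₂(δ₂ g)` (HKIS (b) + step 2's KKT letter). [folklore] -/
theorem multiplier_comp {V : E → ℝ} {G₂ : F → G} {δ₁ : F → E} {δ₂ : G → F} {lam₁ : F → (F →L[ℝ] ℝ)}
    {lam₂ : G → (G →L[ℝ] ℝ)} {g : G} (hgrad₁ : fderiv ℝ (V ∘ δ₁) (δ₂ g) = lam₁ (δ₂ g))
    (hkkt₂ : fderiv ℝ (V ∘ δ₁) (δ₂ g) = (lam₂ g).comp (fderiv ℝ G₂ (δ₂ g))) :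
    lam₁ (δ₂ g) = (lam₂ g).comp (fderiv ℝ G₂ (δ₂ g)) := by
  rw [← hgrad₁, hkkt₂]

end KKT

/-! ## §2. The quadratic model: constrained Schur pairs compose (`…ConstrainedSchurForm` §3's letters BY SHAPE) -/

section Schur

open scoped RealInnerProductSpace

variable {E F G : Type*} [NormedAddCommGroup E] [InnerProductSpace ℝ E] [NormedAddCommGroup F] [InnerProductSpace ℝ F]
  [NormedAddCommGroup G] [InnerProductSpace ℝ G]

/-- **CONSTRAINED SCHUR COMPLEMENTS COMPOSE (inverse-free).**  In `…ConstrainedSchurForm` §3's letters — a constrained minimiser ∕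
multiplier pair `(M₁, Λ₁)` of `(H, D₁)`: `D₁ (M₁ w) = w`, `⟪H (M₁ w), δ⟫ = ⟪Λ₁ w, D₁ δ⟫` («`H M₁ = D₁† Λ₁`», `Λ₁` = «`(D₁ H⁻¹ D₁†)⁻¹`»
without inverses) — and a pair `(M₂, Λ₂)` of `(Λ₁, D₂)` (the NEXT quadratic form is the multiplier form): the pair `(M₁ ∘ M₂, Λ₂)` serves
`(H, D₂ ∘ D₁)`.  So the constrained Schur complement under `D₂ ∘ D₁` IS the complement under `D₂` of the complement under `D₁` — the
`Δ_k`-recursion of the Gaussian skeleton and its closed form agree (two rewrites). [folklore] -/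
theorem schur_pair_comp (H : E →ₗ[ℝ] E) (D₁ : E →ₗ[ℝ] F) (D₂ : F →ₗ[ℝ] G) (M₁ : F → E) (Λ₁ : F → F) (M₂ : G → F)
    (Λ₂ : G → G) (hM₁ : ∀ w, D₁ (M₁ w) = w) (hΛ₁ : ∀ (w : F) (δ : E), ⟪H (M₁ w), δ⟫ = ⟪Λ₁ w, D₁ δ⟫)
    (hM₂ : ∀ g, D₂ (M₂ g) = g) (hΛ₂ : ∀ (g : G) (v : F), ⟪Λ₁ (M₂ g), v⟫ = ⟪Λ₂ g, D₂ v⟫) :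
    (∀ g, D₂ (D₁ (M₁ (M₂ g))) = g) ∧ ∀ (g : G) (δ : E), ⟪H (M₁ (M₂ g)), δ⟫ = ⟪Λ₂ g, D₂ (D₁ δ)⟫ :=
  ⟨fun g => by rw [hM₁, hM₂], fun g δ => by rw [hΛ₁, hΛ₂]⟩

/-- The composite's multiplier FORM is the second step's: `⟪M₁ M₂ g, H (M₁ M₂ g)⟫ = ⟪g, Λ₂ g⟫` (`…ConstrainedSchurForm.min_eq_multiplierForm`'s
shape at the composite pair). [folklore] -/
theorem schur_pair_comp_form (H : E →ₗ[ℝ] E) (D₁ : E →ₗ[ℝ] F) (D₂ : F →ₗ[ℝ] G) (M₁ : F → E) (Λ₁ : F → F) (M₂ : G → F)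
    (Λ₂ : G → G) (hM₁ : ∀ w, D₁ (M₁ w) = w) (hΛ₁ : ∀ (w : F) (δ : E), ⟪H (M₁ w), δ⟫ = ⟪Λ₁ w, D₁ δ⟫)
    (hM₂ : ∀ g, D₂ (M₂ g) = g) (hΛ₂ : ∀ (g : G) (v : F), ⟪Λ₁ (M₂ g), v⟫ = ⟪Λ₂ g, D₂ v⟫) (g : G) :
    ⟪M₁ (M₂ g), H (M₁ (M₂ g))⟫ = ⟪g, Λ₂ g⟫ := by
  rw [real_inner_comm, hΛ₁, hM₁, hΛ₂, hM₂, real_inner_comm]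

end Schur

/-! ## §3. Toys -/

/-- Toy (§1 shape check on `ℝ`, everything the identity ∕ `V = id`-free): with `G₁ = G₂ = δ₁ = δ₂ = id` and `λ₁ = λ₂ = DV`, the
composite KKT letter is the chain rule for `id ∘ id`. -/
example (V : ℝ → ℝ) (g : ℝ) (lam : ℝ → (ℝ →L[ℝ] ℝ)) (hkkt : fderiv ℝ V g = (lam g).comp (fderiv ℝ (id : ℝ → ℝ) g))
    (hgrad : fderiv ℝ (V ∘ id) g = lam g) :
    fderiv ℝ V (id (id g)) = (lam g).comp (fderiv ℝ ((id : ℝ → ℝ) ∘ id) (id (id g))) :=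
  kkt_comp (G₁ := id) (G₂ := id) (δ₁ := id) (δ₂ := id) (lam₁ := lam) (lam₂ := lam) rfl differentiableAt_id
    differentiableAt_id hkkt hgrad (by simpa using hkkt)

section ToySchur

open scoped RealInnerProductSpace

/-- Toy (§2 on `ℝ`, shape check): `H = D₁ = D₂ = 1`, `M₁ = M₂ = Λ₁ = Λ₂ = id` — the identity pairs compose to the identity pair. -/
example : (∀ g : ℝ, LinearMap.id (R := ℝ) (LinearMap.id (R := ℝ) (id (id g))) = g) ∧
    ∀ g δ : ℝ, ⟪LinearMap.id (R := ℝ) (id (id g)), δ⟫ = ⟪id g, LinearMap.id (R := ℝ) (LinearMap.id (R := ℝ) δ)⟫ :=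
  schur_pair_comp LinearMap.id LinearMap.id LinearMap.id id id id id (fun _ => rfl) (fun _ _ => rfl) (fun _ => rfl)
    (fun _ _ => rfl)

end ToySchur

end Summit.QuantumFields.BalabanUV.T4Continuum.NE7b.HardStepSemigroupPairs
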